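import Summits.CriticalPhenomena.PercolationContinuityZ3.Theorems.PercNearOneGluingNoHeavyLowerTailFKPhiMassSections
import HarnessLib

/-!
# FK sub-lane: the second Bernstein deformation — pivot lemma, two-pair FKG minor, monotonicity minor (partition-function form)

Support file (`--supports stmt-CriticalPhenomena-4575`), FK sub-lane `prim-bschramm-fk-2` (gen 4); builds on p205010 (kernel theorem,
internal audit signed; external expert review pending).  No definitions, no named facts, no sorries; standard axioms.

The algebra and the two sign inputs of fk-2 gen 4's induction for Lemma Φ(b)_FK (`FK.PhiFKMonotone`, bschramm/FK-Q2.md §13):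
* `FK.det_affine_nonneg` — the (★★) device of gen 3's `Δ_N` induction (prim-hp-7's second Bernstein deformation, HP7-MDLX-PROOF §3):
  a `2×2` determinant `A(u)b(u) − a(u)B(u)` of affine functions is `≥ 0` on `[0,1]` as soon as both endpoint determinants are `≥ 0`
  and the cross product `(A⁰a¹ − A¹a⁰)(b¹a⁰ − b⁰a¹) ≥ 0` (pivot `a > 0`); `FK.affine_ratio_le_left` — the Möbius ratio is monotone;
* `FK.zMass_two_pair_fkg` — positive correlation of two pairs under `φ_{G−K̄}` (`q ≥ 1`, Lemma 2.2 / Grimmett Thm. (3.8)) in the form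
  `Z[f↦1,f'↦0]·Z[f↦0,f'↦1] ≤ Z[f↦1,f'↦1]·Z[f↦0,f'↦0]`;
* `FK.zMass_mono_minor` — comparison in `𝐩` (Grimmett Thm. (3.21)): `φ_{G−K̄'}(f open) ≤ φ_{G−K̄}(f open)` for `K ⊆ K'`, as
  `Z_K[f↦0]·Z_{K'}[f↦1] ≤ Z_K[f↦1]·Z_{K'}[f↦0]`.
[cite: Grimmett2006, §1.4 eq. (1.20) (p. 15); Thm. (3.1)(a); Thm. (3.8); Thm. (3.21) (p. 44)] [cite: VandenbergHaggstromKahn2005, §2.1 Lemma 2.2 (p. 10)]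
-/

noncomputable section

namespace Summit.CriticalPhenomena.PercolationContinuityZ3.Theorems.FK

open MeasureTheory Set Literature.Probability.LatticeModels Literature.Probability.Percolation
open Literature.Probability.Percolation.DecisionTree (ind ind_of_mem ind_of_not_mem ind_nonneg)
open Literature.Probability.Percolation.BHK2006 (rcMass rcMass_nonneg delW rcMass_fkg sum_rcMass_mono_weights delW_anti)
open Summit.CriticalPhenomena.PercolationContinuityZ3.Theorems.HullPort (cut avoidEv)
open scoped Classical

variable {V : Type*} [Fintype V]

/-! ### The Bernstein–pivot lemma (pure algebra) -/

/-- **Second Bernstein deformation, pivot form** (the (★★) device of prim-hp-7's `T_A` induction, bschramm/FK-Q2.md §12.2/§13): for a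
`2×2` determinant `Δ(u) = A(u)b(u) − a(u)B(u)` of functions affine in `u ∈ [0,1]` with `a(0), a(1) > 0`, if both endpoint determinants
are `≥ 0` and the cross product `(A⁰a¹ − A¹a⁰)(b¹a⁰ − b⁰a¹) ≥ 0`, then `Δ(u) ≥ 0`:
`a⁰a¹·MIX = (a¹)²Δ⁰⁰ + (a⁰)²Δ¹¹ + (A⁰a¹ − A¹a⁰)(b¹a⁰ − b⁰a¹)`. (transcription of the cell memo prim-hp-7 HP7-MDLX-PROOF.md §3 (★)) [folklore] -/
theorem det_affine_nonneg {u A₀ A₁ b₀ b₁ a₀ a₁ B₀ B₁ : ℝ} (hu0 : 0 ≤ u) (hu1 : u ≤ 1) (ha₀ : 0 < a₀) (ha₁ : 0 < a₁)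
    (h00 : 0 ≤ A₀ * b₀ - a₀ * B₀) (h11 : 0 ≤ A₁ * b₁ - a₁ * B₁)
    (hcross : 0 ≤ (A₀ * a₁ - A₁ * a₀) * (b₁ * a₀ - b₀ * a₁)) :
    0 ≤ ((1 - u) * A₀ + u * A₁) * ((1 - u) * b₀ + u * b₁) - ((1 - u) * a₀ + u * a₁) * ((1 - u) * B₀ + u * B₁) := by
  set MIX : ℝ := A₀ * b₁ + A₁ * b₀ - a₀ * B₁ - a₁ * B₀ with hMIX
  have hid : a₀ * a₁ * MIX = a₁ ^ 2 * (A₀ * b₀ - a₀ * B₀) + a₀ ^ 2 * (A₁ * b₁ - a₁ * B₁) +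
      (A₀ * a₁ - A₁ * a₀) * (b₁ * a₀ - b₀ * a₁) := by
    simp only [hMIX]; ring
  have hM : 0 ≤ MIX := by
    have h : 0 ≤ a₀ * a₁ * MIX := by rw [hid]; positivity
    exact (mul_nonneg_iff_of_pos_left (mul_pos ha₀ ha₁)).1 h
  have hexp : ((1 - u) * A₀ + u * A₁) * ((1 - u) * b₀ + u * b₁) - ((1 - u) * a₀ + u * a₁) * ((1 - u) * B₀ + u * B₁) =
      (1 - u) ^ 2 * (A₀ * b₀ - a₀ * B₀) + u * (1 - u) * MIX + u ^ 2 * (A₁ * b₁ - a₁ * B₁) := by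
    simp only [hMIX]; ring
  rw [hexp]
  have h1u : 0 ≤ 1 - u := sub_nonneg.2 hu1
  positivity

/-- **Möbius monotonicity from the endpoint determinant**: if `z¹α⁰ − z⁰α¹ ≥ 0` with `z⁰ > 0` and `z(u) > 0`, then the ratio
`α(u)/z(u)` of the affine interpolants is at most `α⁰/z⁰` for `u ∈ [0,1]`. [folklore] -/
theorem affine_ratio_le_left {u α₀ α₁ z₀ z₁ : ℝ} (hu0 : 0 ≤ u) (hz₀ : 0 < z₀) (hz : 0 < (1 - u) * z₀ + u * z₁)
    (hX : 0 ≤ z₁ * α₀ - z₀ * α₁) :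
    ((1 - u) * α₀ + u * α₁) / ((1 - u) * z₀ + u * z₁) ≤ α₀ / z₀ := by
  rw [div_le_div_iff₀ hz hz₀]
  nlinarith [mul_nonneg hu0 hX]

/-! ### Positive correlation of two pairs and monotonicity in the deleted set, in partition-function form -/

/-- The mass of `{e open}` under `u[e ↦ 1]` is the full partition function (a weight-one pair is almost surely open), and under
`u[e ↦ 0]` it vanishes. [cite: Grimmett2006, §1.4 eq. (1.20) (p. 15)] -/
theorem sum_rcWeightW_update_one_mul_ind (u : Sym2 V → unitInterval) (q : ℝ) (e : Sym2 V) (h : BondConfig V → ℝ) :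
    ∑ ω, rcWeightW (Function.update u e 1) q ∅ ω * (ind {ω : BondConfig V | e ∈ ω} ω * h ω) =
      ∑ ω, rcWeightW (Function.update u e 1) q ∅ ω * h ω := by
  refine Finset.sum_congr rfl fun ω _ => ?_
  by_cases he : e ∈ ω
  · rw [ind_of_mem (show ω ∈ {ω : BondConfig V | e ∈ ω} from he), one_mul]
  · rw [rcWeightW_eq_zero_of_one_not_mem _ q ∅ (by simp) he, zero_mul, zero_mul]

/-- The mass of `{e open}` under `u[e ↦ 0]` vanishes. [cite: Grimmett2006, §1.4 eq. (1.20) (p. 15)] -/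
theorem sum_rcWeightW_update_zero_mul_ind (u : Sym2 V → unitInterval) (q : ℝ) (e : Sym2 V) (h : BondConfig V → ℝ) :
    ∑ ω, rcWeightW (Function.update u e 0) q ∅ ω * (ind {ω : BondConfig V | e ∈ ω} ω * h ω) = 0 := by
  refine Finset.sum_eq_zero fun ω _ => ?_
  by_cases he : e ∈ ω
  · rw [rcWeightW_eq_zero_of_zero_mem _ q ∅ (by simp) he, zero_mul]
  · rw [ind_of_not_mem (show ω ∉ {ω : BondConfig V | e ∈ ω} from he), zero_mul, mul_zero]

/-- Section of a weighted sum at the midpoint parameter `½`: `Σ w_q[e↦½] h = ½ Σ w_q[e↦0] h + ½ Σ w_q[e↦1] h`.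
[cite: Grimmett2006, Thm. (3.1)(a), eq. (1.20)] -/
theorem sum_rcWeightW_update_half (u : Sym2 V → unitInterval) (q : ℝ) (e : Sym2 V) (h : BondConfig V → ℝ) :
    ∑ ω, rcWeightW (Function.update u e ⟨1/2, by norm_num, by norm_num⟩) q ∅ ω * h ω =
      1/2 * ∑ ω, rcWeightW (Function.update u e 0) q ∅ ω * h ω + 1/2 * ∑ ω, rcWeightW (Function.update u e 1) q ∅ ω * h ω := by
  rw [Finset.mul_sum, Finset.mul_sum, ← Finset.sum_add_distrib]
  refine Finset.sum_congr rfl fun ω _ => ?_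
  rw [rcWeightW_affine (Function.update u e ⟨1/2, by norm_num, by norm_num⟩) q ∅ e ω]
  simp only [Function.update_idem, Function.update_self]
  ring

/-- **Positive correlation of two pairs, partition-function form** (FKG for `φ_{𝐩,q}`, `q ≥ 1`): for pairs `f ≠ f'` not meeting `K`,
`Z_{G−K̄}[f↦1,f'↦1]·Z[f↦0,f'↦0] ≥ Z[f↦1,f'↦0]·Z[f↦0,f'↦1]`.
[cite: VandenbergHaggstromKahn2005, §2.1 Lemma 2.2 (p. 10)] [cite: Grimmett2006, Thm. (3.8)] -/
theorem zMass_two_pair_fkg (w : Sym2 V → unitInterval) {q : ℝ} (hq : 1 ≤ q) {K : Set V} {f f' : Sym2 V}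
    (hf : f ∉ CSH.edgesOf K) (hf' : f' ∉ CSH.edgesOf K) (hff' : f ≠ f') :
    zMass (Function.update (Function.update w f 1) f' 0) q K * zMass (Function.update (Function.update w f 0) f' 1) q K ≤
      zMass (Function.update (Function.update w f 1) f' 1) q K * zMass (Function.update (Function.update w f 0) f' 0) q K := by
  have hq0 : 0 < q := one_pos.trans_le hq
  set half : unitInterval := ⟨1/2, by norm_num, by norm_num⟩ with hhalf
  set u : Sym2 V → unitInterval := delW w (CSH.edgesOf K) with hu
  set uh : Sym2 V → unitInterval := Function.update (Function.update u f half) f' half with huh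
  -- the corner partition functions
  have hcorner : ∀ a b : unitInterval, zMass (Function.update (Function.update w f a) f' b) q K =
      ∑ ω, rcWeightW (Function.update (Function.update u f a) f' b) q ∅ ω := by
    intro a b
    unfold zMass rcPartitionFunctionW
    rw [delW_update_of_not_mem _ hf', delW_update_of_not_mem _ hf]
  set F : BondConfig V → ℝ := ind {ω : BondConfig V | f ∈ ω} with hF
  set G : BondConfig V → ℝ := ind {ω : BondConfig V | f' ∈ ω} with hG
  have hFm : Monotone F := fun a b hab => by
    simp only [hF]
    by_cases ha : f ∈ a
    · rw [ind_of_mem (show a ∈ {ω : BondConfig V | f ∈ ω} from ha), ind_of_mem (show b ∈ {ω : BondConfig V | f ∈ ω} from hab ha)]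
    · rw [ind_of_not_mem (show a ∉ {ω : BondConfig V | f ∈ ω} from ha)]; exact ind_nonneg _ _
  have hGm : Monotone G := fun a b hab => by
    simp only [hG]
    by_cases ha : f' ∈ a
    · rw [ind_of_mem (show a ∈ {ω : BondConfig V | f' ∈ ω} from ha), ind_of_mem (show b ∈ {ω : BondConfig V | f' ∈ ω} from hab ha)]
    · rw [ind_of_not_mem (show a ∉ {ω : BondConfig V | f' ∈ ω} from ha)]; exact ind_nonneg _ _
  have key := rcMass_fkg uh hq hFm hGm
  -- convert to unnormalised masses
  have hZ := rcPartitionFunctionW_pos uh hq0 ∅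
  have hmass : ∀ h : BondConfig V → ℝ, ∑ ω, rcMass uh q ω * h ω = (∑ ω, rcWeightW uh q ∅ ω * h ω) / rcPartitionFunctionW uh q ∅ := by
    intro h; rw [Finset.sum_div]; exact Finset.sum_congr rfl fun ω _ => by unfold rcMass; ring
  rw [hmass, hmass, hmass] at key
  rw [div_mul_div_comm, div_le_div_iff₀ (mul_pos hZ hZ) hZ] at key
  have key' : (∑ ω, rcWeightW uh q ∅ ω * F ω) * (∑ ω, rcWeightW uh q ∅ ω * G ω) ≤
      (∑ ω, rcWeightW uh q ∅ ω * (F ω * G ω)) * rcPartitionFunctionW uh q ∅ := by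
    have := key; nlinarith [hZ]
  -- two-step expansion of a sum under `uh` into the four corners
  set S : unitInterval → unitInterval → (BondConfig V → ℝ) → ℝ := fun a b h =>
    ∑ ω, rcWeightW (Function.update (Function.update u f a) f' b) q ∅ ω * h ω with hS
  have hexp : ∀ h : BondConfig V → ℝ, ∑ ω, rcWeightW uh q ∅ ω * h ω =
      1/2 * (1/2 * S 0 0 h + 1/2 * S 1 0 h) + 1/2 * (1/2 * S 0 1 h + 1/2 * S 1 1 h) := by
    intro h
    simp only [huh, hS]
    rw [sum_rcWeightW_update_half]
    congr 1
    · rw [Function.update_comm hff', sum_rcWeightW_update_half, Function.update_comm (Ne.symm hff'),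
        Function.update_comm (Ne.symm hff')]
    · rw [Function.update_comm hff', sum_rcWeightW_update_half, Function.update_comm (Ne.symm hff'),
        Function.update_comm (Ne.symm hff')]
  -- vanishing / absorption at the corners
  have hF0 : ∀ (b : unitInterval) (h : BondConfig V → ℝ), S 0 b (fun ω => F ω * h ω) = 0 := by
    intro b h; simp only [hS, hF]; rw [Function.update_comm hff']; exact sum_rcWeightW_update_zero_mul_ind _ q f h
  have hF1 : ∀ (b : unitInterval) (h : BondConfig V → ℝ), S 1 b (fun ω => F ω * h ω) = S 1 b h := by
    intro b h; simp only [hS, hF]; rw [Function.update_comm hff']; exact sum_rcWeightW_update_one_mul_ind _ q f h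
  have hG0 : ∀ (a : unitInterval) (h : BondConfig V → ℝ), S a 0 (fun ω => G ω * h ω) = 0 := by
    intro a h; simp only [hS, hG]; exact sum_rcWeightW_update_zero_mul_ind _ q f' h
  have hG1 : ∀ (a : unitInterval) (h : BondConfig V → ℝ), S a 1 (fun ω => G ω * h ω) = S a 1 h := by
    intro a h; simp only [hS, hG]; exact sum_rcWeightW_update_one_mul_ind _ q f' h
  have hone : ∀ a b : unitInterval, S a b (fun _ => (1 : ℝ)) = zMass (Function.update (Function.update w f a) f' b) q K := by
    intro a b; rw [hcorner]; simp only [hS, mul_one]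
  -- the four masses
  have eF : ∑ ω, rcWeightW uh q ∅ ω * F ω = 1/2 * (1/2 * 0 + 1/2 * S 1 0 (fun _ => 1)) + 1/2 * (1/2 * 0 + 1/2 * S 1 1 (fun _ => 1)) := by
    have := hexp (fun ω => F ω * 1)
    simp only [mul_one] at this
    rw [this]
    have a0 := hF0 0 (fun _ => 1); have a1 := hF0 1 (fun _ => 1); have b0 := hF1 0 (fun _ => 1); have b1 := hF1 1 (fun _ => 1)
    simp only [mul_one] at a0 a1 b0 b1
    rw [a0, a1, b0, b1]
  have eG : ∑ ω, rcWeightW uh q ∅ ω * G ω = 1/2 * (1/2 * 0 + 1/2 * 0) + 1/2 * (1/2 * S 0 1 (fun _ => 1) + 1/2 * S 1 1 (fun _ => 1)) := by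
    have := hexp (fun ω => G ω * 1)
    simp only [mul_one] at this
    rw [this]
    have a0 := hG0 0 (fun _ => 1); have a1 := hG0 1 (fun _ => 1); have b0 := hG1 0 (fun _ => 1); have b1 := hG1 1 (fun _ => 1)
    simp only [mul_one] at a0 a1 b0 b1
    rw [a0, a1, b0, b1]
  have eFG : ∑ ω, rcWeightW uh q ∅ ω * (F ω * G ω) = 1/2 * (1/2 * 0 + 1/2 * 0) + 1/2 * (1/2 * 0 + 1/2 * S 1 1 (fun _ => 1)) := by
    rw [hexp (fun ω => F ω * G ω)]
    have a0 := hF0 0 G; have a1 := hF0 1 G; have b0 := hF1 0 G; have b1 := hF1 1 G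
    rw [a0, a1, b0, b1]
    have c0 := hG0 1 (fun _ => 1); have c1 := hG1 1 (fun _ => 1)
    simp only [mul_one] at c0 c1
    rw [show (G : BondConfig V → ℝ) = fun ω => G ω from rfl] at c0 c1
    rw [c0, c1]
  have eZ : rcPartitionFunctionW uh q ∅ = 1/2 * (1/2 * S 0 0 (fun _ => 1) + 1/2 * S 1 0 (fun _ => 1)) +
      1/2 * (1/2 * S 0 1 (fun _ => 1) + 1/2 * S 1 1 (fun _ => 1)) := by
    have := hexp (fun _ => 1)
    simp only [mul_one] at this
    unfold rcPartitionFunctionW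
    rw [this]
  rw [eF, eG, eFG, eZ, hone, hone, hone, hone] at key'
  -- positivity of the corner partition functions
  have hz : ∀ a b : unitInterval, 0 < zMass (Function.update (Function.update w f a) f' b) q K := fun a b =>
    rcPartitionFunctionW_pos _ hq0 ∅
  nlinarith [key', hz 0 0, hz 0 1, hz 1 0, hz 1 1]

/-- **Monotonicity in the deleted set, partition-function form** (comparison in `𝐩` for `φ_{𝐩,q}`, `q ≥ 1`): for `K ⊆ K'` and a
pair `f` not meeting `K'`, `Z_{G−K̄}[f↦0]·Z_{G−K̄'}[f↦1] ≤ Z_{G−K̄}[f↦1]·Z_{G−K̄'}[f↦0]`, i.e. `φ_{G−K̄'}(f open) ≤ φ_{G−K̄}(f open)`.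
[cite: Grimmett2006, Thm. (3.21) (p. 44)] -/
theorem zMass_mono_minor (w : Sym2 V → unitInterval) {q : ℝ} (hq : 1 ≤ q) {K K' : Set V} (hKK' : K ⊆ K') {f : Sym2 V}
    (hf' : f ∉ CSH.edgesOf K') :
    zMass (Function.update w f 0) q K * zMass (Function.update w f 1) q K' ≤
      zMass (Function.update w f 1) q K * zMass (Function.update w f 0) q K' := by
  have hq0 : 0 < q := one_pos.trans_le hq
  have hf : f ∉ CSH.edgesOf K := fun h => hf' (CSH.edgesOf_mono hKK' h)
  set half : unitInterval := ⟨1/2, by norm_num, by norm_num⟩ with hhalf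
  set u : Sym2 V → unitInterval := Function.update (delW w (CSH.edgesOf K)) f half with hu
  set u' : Sym2 V → unitInterval := Function.update (delW w (CSH.edgesOf K')) f half with hu'
  have hle : ∀ e, u' e ≤ u e := by
    intro e
    by_cases he : e = f
    · subst he; simp only [hu, hu', Function.update_self]; exact le_rfl
    · simp only [hu, hu', Function.update_of_ne he]
      exact delW_anti w (CSH.edgesOf_mono hKK') e
  set F : BondConfig V → ℝ := ind {ω : BondConfig V | f ∈ ω} with hF
  have hFm : Monotone F := fun a b hab => by
    simp only [hF]
    by_cases ha : f ∈ a
    · rw [ind_of_mem (show a ∈ {ω : BondConfig V | f ∈ ω} from ha), ind_of_mem (show b ∈ {ω : BondConfig V | f ∈ ω} from hab ha)]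
    · rw [ind_of_not_mem (show a ∉ {ω : BondConfig V | f ∈ ω} from ha)]; exact ind_nonneg _ _
  have key := sum_rcMass_mono_weights hle hq hFm
  -- unnormalise
  have hmass : ∀ (v : Sym2 V → unitInterval) (h : BondConfig V → ℝ),
      ∑ ω, rcMass v q ω * h ω = (∑ ω, rcWeightW v q ∅ ω * h ω) / rcPartitionFunctionW v q ∅ := by
    intro v h; rw [Finset.sum_div]; exact Finset.sum_congr rfl fun ω _ => by unfold rcMass; ring
  rw [hmass, hmass] at key
  -- corner identification
  have hc : ∀ (L : Set V) (c : unitInterval), f ∉ CSH.edgesOf L →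
      ∑ ω, rcWeightW (Function.update (delW w (CSH.edgesOf L)) f c) q ∅ ω = zMass (Function.update w f c) q L := by
    intro L c hL; unfold zMass rcPartitionFunctionW; rw [delW_update_of_not_mem _ hL]
  have eN : ∀ (L : Set V), f ∉ CSH.edgesOf L →
      ∑ ω, rcWeightW (Function.update (delW w (CSH.edgesOf L)) f half) q ∅ ω * F ω = 1/2 * 0 + 1/2 * zMass (Function.update w f 1) q L := by
    intro L hL
    have := sum_rcWeightW_update_half (delW w (CSH.edgesOf L)) q f (fun ω => F ω * 1)
    simp only [mul_one] at this
    rw [this]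
    have a0 := sum_rcWeightW_update_zero_mul_ind (delW w (CSH.edgesOf L)) q f (fun _ => 1)
    have a1 := sum_rcWeightW_update_one_mul_ind (delW w (CSH.edgesOf L)) q f (fun _ => 1)
    simp only [mul_one] at a0 a1
    simp only [hF]
    rw [a0, a1, hc L 1 hL]
  have eZ : ∀ (L : Set V), f ∉ CSH.edgesOf L →
      rcPartitionFunctionW (Function.update (delW w (CSH.edgesOf L)) f half) q ∅ =
        1/2 * zMass (Function.update w f 0) q L + 1/2 * zMass (Function.update w f 1) q L := by
    intro L hL
    have := sum_rcWeightW_update_half (delW w (CSH.edgesOf L)) q f (fun _ => 1)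
    simp only [mul_one] at this
    unfold rcPartitionFunctionW
    rw [this, hc L 0 hL, hc L 1 hL]
  simp only [hu, hu'] at key
  rw [eN K hf, eN K' hf', eZ K hf, eZ K' hf'] at key
  have hz : ∀ (L : Set V) (c : unitInterval), 0 < zMass (Function.update w f c) q L := fun L c => rcPartitionFunctionW_pos _ hq0 ∅
  have h1 := hz K 0; have h2 := hz K 1; have h3 := hz K' 0; have h4 := hz K' 1
  rw [div_le_div_iff₀ (by positivity) (by positivity)] at key
  nlinarith [key, h1, h2, h3, h4]

end Summit.CriticalPhenomena.PercolationContinuityZ3.Theorems.FK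

end
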